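import Summits.Ventures.Crystal3D.Theorems.StickyWulffConstantNoReconstructionGainGrainFrameLocal
import HarnessLib

/-!
# Frame-registered films (misoriented grains at every normal): the atom from a spherical cap budget

HONEST FRAMING. Part of the venture `Summits/Ventures/Crystal3D` (cell `crystal3d-full`), helper
`--supports` the crux `NoReconstructionGain` (stmt-Ventures-19144, route
`route-Ventures-StickyWulffConstant`), line `adhesion` (wulff-p1 g11); the film-level half of
`…GrainFrameLocal` (per-ball reduction `perBall_frameFilm_le`).  Class (iii) of the line's census —
films OFF the substrate lattice: misoriented grains.

* `frameFilm_cross_le_of_capBudget` — `U` a registration frame (twelve unit vectors, closed under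
  negation, pairwise `⟪d, d'⟫ ≤ 1/2`) satisfying the CAP BUDGET (the spherical statement, inline: at
  most three unit vectors `u` with `⟪u, ν⟫ ≤ −t`, pairwise `≥ 60°` apart, see at least as many directions
  `d ∈ U` with `⟪d, ν⟫ < 0` that are steep (`⟪d, ν⟫ ≤ −t`) or blocked (`⟪u, d⟫ > 1/2` for some `u`), level
  blocked ones counting `½`); `X` any finite unit packing, `P ⊆ X` ANY substrate below the cut
  `⟪·, ν⟫ ≤ −R`, film above the cut, `U`-registered (every film–film contact vector in `U`), each film
  ball touching `≤ 3` substrate balls.  Then `#cross(P, X∖P) ≤ D(X∖P)` — no error term, every unit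
  `ν`, every `R`: summing `perBall_frameFilm_le` over the exact identity `frameGain_eq`.
* `grainFilm_slab_of_capBudget` (**rung**, registered by name on stmt-Ventures-19144; `R = 1`,
  `C = 0`) — the atom in slab form around the fcc `ν`-slab sample for films above the cut, off `Λ₀`,
  whose film–film contact vectors lie in `A Λ₀` (`A` a linear isometry; e.g. any subset of one moved
  lattice `A Λ₀ + s`: a misoriented fcc grain of any orientation, position and shape, with vacancies),
  GIVEN the cap budget of the moved bond star `A U₀`.  Numerically (adversarial search over SO(3) × t,
  lead folder `calc/sc_*.py`) the cap budget holds for every rotated fcc star with cosine margin `≥ 0.07`;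
  it is the registered open brick `stub_frameCapBudget` of skeleton v12.

WHAT THIS IS NOT: the cap budget is not proved here; polycrystalline / amorphous films (bonds outside one
frame) and on-lattice coincidence sites are not touched; rung F-C1 not moved.
-/

noncomputable section

namespace Summit.Ventures.Crystal3D.Theorems

open Summit.Ventures.Crystal3D Finset
open Literature.MathematicalPhysics.StatisticalMechanics (fccStacking orderedContacts contactDeficiency)
open scoped InnerProductSpace

/-- **Frame-registered films gain nothing, given the cap budget of the frame.**  `U` a registration
frame (twelve unit vectors, closed under negation, pairwise `⟪d, d'⟫ ≤ 1/2`) satisfying the cap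
budget; `X` a finite unit packing, `P ⊆ X` below the cut `⟪·, ν⟫ ≤ −R`, the film `X ∖ P` above it,
`U`-registered, each film ball touching at most three substrate balls.  Then
`#cross(P, X∖P) ≤ D(X∖P)` — no error term, every unit normal `ν`, every `R`. -/
theorem frameFilm_cross_le_of_capBudget (X P : Finset (EuclideanSpace ℝ (Fin 3)))
    (hX : ∀ p ∈ X, ∀ q ∈ X, p ≠ q → 1 ≤ dist p q) (hPX : P ⊆ X)
    (U : Finset (EuclideanSpace ℝ (Fin 3))) (hU1 : ∀ d ∈ U, ‖d‖ = 1)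
    (hUsep : ∀ d ∈ U, ∀ d' ∈ U, d ≠ d' → ⟪d, d'⟫_ℝ ≤ 1 / 2) (hUneg : ∀ d ∈ U, -d ∈ U)
    (hUcard : U.card = 12)
    (hcap : ∀ ν : EuclideanSpace ℝ (Fin 3), ‖ν‖ = 1 → ∀ t : ℝ, 0 < t →
      ∀ K : Finset (EuclideanSpace ℝ (Fin 3)), K.card ≤ 3 →
      (∀ u ∈ K, ‖u‖ = 1 ∧ ⟪u, ν⟫_ℝ ≤ -t) → (∀ u ∈ K, ∀ u' ∈ K, u ≠ u' → ⟪u, u'⟫_ℝ ≤ 1 / 2) →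
      (K.card : ℝ) ≤
        ((U.filter fun d => ⟪d, ν⟫_ℝ < 0 ∧ ((∃ u ∈ K, 1 / 2 < ⟪u, d⟫_ℝ) ∨ ⟪d, ν⟫_ℝ ≤ -t)).card : ℝ)
          + (1 / 2) * ((U.filter fun d => ⟪d, ν⟫_ℝ = 0 ∧ ∃ u ∈ K, 1 / 2 < ⟪u, d⟫_ℝ).card : ℝ))
    (ν : EuclideanSpace ℝ (Fin 3)) (hν : ‖ν‖ = 1) (R : ℝ)
    (hbelow : ∀ p ∈ P, ⟪p, ν⟫_ℝ ≤ -R) (habove : ∀ x ∈ X \ P, -R < ⟪x, ν⟫_ℝ)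
    (h3 : ∀ q ∈ X \ P, (P.filter fun p => dist q p = 1).card ≤ 3)
    (hreg : ∀ q ∈ X \ P, ∀ x ∈ X \ P, dist q x = 1 → x - q ∈ U) :
    ((((P ×ˢ (X \ P)).filter fun pq => dist pq.1 pq.2 = 1).card : ℕ) : ℝ) ≤
      contactDeficiency (X \ P) := by
  classical
  have hc3 : Real.sqrt 3 / 2 ≤ Real.sqrt 3 / 2 := le_rfl
  have hUsep' : ∀ d ∈ U, ∀ d' ∈ U, d ≠ d' → ⟪d, d'⟫_ℝ ≤ 2 * (Real.sqrt 3 / 2) ^ 2 - 1 := by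
    intro d hd d' hd' hne; rw [two_mul_sqrt_three_div_two_sq_sub_one]; exact hUsep d hd d' hd' hne
  rw [frameGain_eq X P hX hPX U (Real.sqrt 3 / 2) hc3 hU1 hUsep' hUneg ν, hUcard]
  have hmid : (((12 : ℕ) : ℝ) - 12) / 2 * ((X \ P).card : ℝ) = 0 := by norm_num
  rw [hmid, add_zero, add_assoc, ← sum_add_distrib]
  have hsum := sum_nonpos fun q hq =>
    perBall_frameFilm_le X P hX hPX U hU1 hUsep hcap ν hν R hbelow habove q hq (h3 q hq) (hreg q hq)
  linarith

/-- **RUNG (registered by name on stmt-Ventures-19144): misoriented-grain films at every normal, from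
the cap budget of the moved bond star** (`R = 1`, `C = 0`).  `U₀` is any twelve-element set of unit
vectors of `Λ₀` closed under negation (= the bond star), `A` any linear isometry; if the moved star
`A U₀` satisfies the cap budget then every finite unit packing around the `ν`-slab sample whose film
lies above the cut, off `Λ₀`, with every film–film contact vector in `A Λ₀` (e.g. the film is a subset
of one moved lattice `A Λ₀ + s`, of any shape) satisfies `#cross(P, X∖P) ≤ D(X∖P) + C ρ`. -/
theorem grainFilm_slab_of_capBudget :
    ∃ R C : ℝ, 1 ≤ R ∧ ∀ U₀ : Finset (EuclideanSpace ℝ (Fin 3)),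
      (∀ d ∈ U₀, d ∈ fccStacking 1 (Real.sqrt (2 / 3)) ∧ ‖d‖ = 1) → (∀ d ∈ U₀, -d ∈ U₀) → U₀.card = 12 →
      ∀ A : EuclideanSpace ℝ (Fin 3) ≃ₗᵢ[ℝ] EuclideanSpace ℝ (Fin 3),
      (∀ ν : EuclideanSpace ℝ (Fin 3), ‖ν‖ = 1 → ∀ t : ℝ, 0 < t →
        ∀ K : Finset (EuclideanSpace ℝ (Fin 3)), K.card ≤ 3 →
        (∀ u ∈ K, ‖u‖ = 1 ∧ ⟪u, ν⟫_ℝ ≤ -t) → (∀ u ∈ K, ∀ u' ∈ K, u ≠ u' → ⟪u, u'⟫_ℝ ≤ 1 / 2) →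
        (K.card : ℝ) ≤
          (((U₀.image fun d => A d).filter fun d =>
              ⟪d, ν⟫_ℝ < 0 ∧ ((∃ u ∈ K, 1 / 2 < ⟪u, d⟫_ℝ) ∨ ⟪d, ν⟫_ℝ ≤ -t)).card : ℝ)
            + (1 / 2) * (((U₀.image fun d => A d).filter fun d =>
              ⟪d, ν⟫_ℝ = 0 ∧ ∃ u ∈ K, 1 / 2 < ⟪u, d⟫_ℝ).card : ℝ)) →
      ∀ ν : EuclideanSpace ℝ (Fin 3), ‖ν‖ = 1 → ∀ ρ : ℝ, R ≤ ρ →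
      ∀ X P : Finset (EuclideanSpace ℝ (Fin 3)),
      (∀ p ∈ X, ∀ q ∈ X, p ≠ q → 1 ≤ dist p q) → P ⊆ X →
      (∀ p, p ∈ P ↔ (p ∈ fccStacking 1 (Real.sqrt (2 / 3)) ∧ -(2 * R) ≤ ⟪p, ν⟫_ℝ ∧
        ⟪p, ν⟫_ℝ ≤ -R ∧ ‖p‖ ^ 2 - ⟪p, ν⟫_ℝ ^ 2 ≤ ρ ^ 2)) →
      (∀ q ∈ X \ P, -R < ⟪q, ν⟫_ℝ) →
      (∀ q ∈ X \ P, q ∉ fccStacking 1 (Real.sqrt (2 / 3))) →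
      (∀ q ∈ X \ P, ∀ x ∈ X \ P, dist q x = 1 → A.symm (x - q) ∈ fccStacking 1 (Real.sqrt (2 / 3))) →
      ((((P ×ˢ (X \ P)).filter fun pq => dist pq.1 pq.2 = 1).card : ℕ) : ℝ) ≤
        contactDeficiency (X \ P) + C * ρ := by
  classical
  refine ⟨1, 0, le_rfl, ?_⟩
  intro U₀ hU₀ hU₀neg hU₀card A hcap ν hν ρ hρ X P hX hPX hP habove hoff hreg
  rw [zero_mul, add_zero]
  set U := U₀.image fun d => A d with hU
  have hAinj : Function.Injective fun d : EuclideanSpace ℝ (Fin 3) => A d := A.injective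
  have hUmem : ∀ d ∈ U, ∃ d₀ ∈ U₀, A d₀ = d := fun d hd => by simpa only [hU, mem_image] using hd
  have hU1 : ∀ d ∈ U, ‖d‖ = 1 := by
    intro d hd
    obtain ⟨d₀, hd₀, rfl⟩ := hUmem d hd
    rw [LinearIsometryEquiv.norm_map]; exact (hU₀ d₀ hd₀).2
  have hUsep : ∀ d ∈ U, ∀ d' ∈ U, d ≠ d' → ⟪d, d'⟫_ℝ ≤ 1 / 2 := by
    intro d hd d' hd' hne
    obtain ⟨d₀, hd₀, rfl⟩ := hUmem d hd
    obtain ⟨d₀', hd₀', rfl⟩ := hUmem d' hd'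
    rw [LinearIsometryEquiv.inner_map_map]
    exact real_inner_le_half_of_fcc_unit (hU₀ d₀ hd₀).1 (hU₀ d₀' hd₀').1 (hU₀ d₀ hd₀).2 (hU₀ d₀' hd₀').2
      (fun h => hne (by rw [h]))
  have hUneg : ∀ d ∈ U, -d ∈ U := by
    intro d hd
    obtain ⟨d₀, hd₀, rfl⟩ := hUmem d hd
    exact mem_image.2 ⟨-d₀, hU₀neg d₀ hd₀, by simp⟩
  have hUcard : U.card = 12 := by rw [hU, card_image_of_injective _ hAinj, hU₀card]
  have hbelow : ∀ p ∈ P, ⟪p, ν⟫_ℝ ≤ -(1 : ℝ) := fun p hp => ((hP p).1 hp).2.2.1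
  have h3 : ∀ q ∈ X \ P, (P.filter fun p => dist q p = 1).card ≤ 3 := by
    intro q hq
    refine fcc_offLattice_unitContacts_le_three q (hoff q hq) _ fun y hy => ?_
    exact ⟨((hP y).1 (mem_filter.1 hy).1).1, (mem_filter.1 hy).2⟩
  have hreg' : ∀ q ∈ X \ P, ∀ x ∈ X \ P, dist q x = 1 → x - q ∈ U := by
    intro q hq x hx hqx
    have hmem := hreg q hq x hx hqx
    have hnorm : ‖A.symm (x - q)‖ = 1 := by
      rw [LinearIsometryEquiv.norm_map, ← dist_eq_norm, dist_comm, hqx]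
    have h0 := fcc_unit_mem_of_bondStar U₀ hU₀ hU₀card hmem hnorm
    exact mem_image.2 ⟨A.symm (x - q), h0, by simp⟩
  exact frameFilm_cross_le_of_capBudget X P hX hPX U hU1 hUsep hUneg hUcard hcap ν hν 1 hbelow habove h3 hreg'

end Summit.Ventures.Crystal3D.Theorems

end
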